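import Mathlib
import HarnessLib
import Summits.Ventures.LatticeQCDFlow.Exactness.KernelCouplingMask

/-!
# A plaquette kernel coupling layer with INVERTIBLE kernels is a measurable automorphism of the gauge-field space — any group, any lattice size, any mask with frozen staples

HONEST FRAMING: exact (Metropolis-corrected) sampling algorithms for lattice gauge theory;
figures of merit are autocorrelation/cost numbers at stated couplings and volumes; no
continuum-physics claim.

Venture `LatticeQCDFlow` (cell pub-lqcd), topic `Exactness`; FANOUT row 10 (`eng-equiv`, engine
`latflow.equiv`: every coupling layer ships a `forward` AND an `inverse` pass — `u1.py` splines via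
`rqs_inverse`, `spectral.spectral_kernel(…, inverse=True)`, `residual.ResidualCoupling.inverse`).
NEW WORK of the cell over `KernelCouplingMask.plaquetteKernelLayer_eq_coupleFun` (frozen staples ⟹
the layer is `Theory2.coupleFun`), `KernelCouplingMask.hasJacobian_plaquetteKernelLayer` and row 31's
`Theory2.coupleEquiv`.  The one-line algebra (`KernelCouplingJacobian.kernel_update_eq`): in ANY group
the active-link update is `u ↦ h(uS)(uS)⁻¹u = h(uS)·S⁻¹`, a bijection of `G` as soon as the kernel `h` is, with inverse
`v ↦ h⁻¹(vS)·S⁻¹`.  Nothing is cited as a fact; no number; no definition (the single-link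
equivalences are anonymous structure instances inside the proof).  The `U(1)` plaquette files
(`U1SplinePlaquetteCouplingEquiv`, `U1DegreeOnePlaquetteCouplingLayer`) prove their instances
directly; this generic form serves the `SU(N)` spectral / residual plaquette layers whose kernels are
bijections (`SpectralCouplingLayerEquiv`, `SUNResidualLayerEquiv`) and any future kernel class.

* **`exists_measurableEquiv_plaquetteKernelLayer`** — measurable group `G` (measurable `mul`, `inv`),
  mask `p` / planes `ν` with the three staple links frozen, kernel field reading frozen links only
  (`hol V e = H e (V|frozen)`) whose ACTIVE kernels are measurable equivalences `φ a y : G ≃ᵐ G`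
  (`H a y = φ a y`) jointly measurable in (loop, frozen links) together with their inverses ⟹
  `∃ Ψ : GaugeConfig d L G ≃ᵐ GaugeConfig d L G` with `⇑Ψ =` the layer and `⇑Ψ.symm =` the layer of
  the inverse kernels;
* **`exists_measurableEquiv_plaquetteKernelLayer_hasJacobian`** — compact group with Haar
  probability per link: adding the active kernels' certificates
  `HasJacobian (Haar) (φ a y) (ofReal ∘ j a y)` (density jointly measurable, nonnegative) gives `Ψ`
  with `HasJacobian (⊗ Haar) Ψ (ofReal ∘ coupleJac p (j at the loops))` — the joint hypothesis of
  `HasJacobian.map_withDensity_equiv` (model density of the sampler) and of the FT-HMC theorems.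
-/

noncomputable section

namespace Summit.Ventures.LatticeQCDFlow.Exactness

open MeasureTheory Summit.Ventures.LatticeQCDFlow.Theory2
open Literature.MathematicalPhysics.QuantumFieldTheory
open scoped ENNReal

variable {d L : ℕ} {G : Type*} [Group G]

section Equiv

variable [MeasurableSpace G] [MeasurableMul₂ G] [MeasurableInv G]
  (p : Edge d L → Prop) [DecidablePred p] (ν : Edge d L → Fin d)
  (h1 : ∀ e, p e → ¬p (e.1.shift e.2, ν e)) (h2 : ∀ e, p e → ¬p (e.1.shift (ν e), e.2))
  (h3 : ∀ e, p e → ¬p (e.1, ν e))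
  (hol : GaugeConfig d L G → Edge d L → G → G)
  (H : Edge d L → ({f : Edge d L // ¬p f} → G) → G → G)
  (hHV : ∀ (V : GaugeConfig d L G) (e : Edge d L), p e → hol V e = H e (fun f => V f))
  (φ : {e : Edge d L // p e} → ({f : Edge d L // ¬p f} → G) → G ≃ᵐ G)
  (hHφ : ∀ (a : {e : Edge d L // p e}) y, H a.1 y = ⇑(φ a y))
  (hφm : ∀ a, Measurable fun q : G × ({f : Edge d L // ¬p f} → G) => φ a q.2 q.1)
  (hφsm : ∀ a, Measurable fun q : G × ({f : Edge d L // ¬p f} → G) => (φ a q.2).symm q.1)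

include hHV hHφ hφm hφsm in
/-- **A plaquette kernel layer with invertible kernels is a measurable automorphism of
`GaugeConfig d L G`.**  Mask `p`, planes `ν` with the three staple links of every active plaquette
frozen (`h1`–`h3`); kernel field `hol V e = H e (V|frozen)` whose active kernels are measurable
equivalences `φ a y` of `G` with forward and inverse maps jointly measurable in (loop, frozen links).
Then there is `Ψ : GaugeConfig d L G ≃ᵐ GaugeConfig d L G` whose forward map is the layer
`V e ↦ hol V e (P) P⁻¹ V e` (active; `P` the active plaquette), `V e` (frozen), and whose inverse is
the layer of the inverse kernels `V e ↦ (φ a (V|frozen))⁻¹(V e · S) · S⁻¹` (`S` the frozen staple). -/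
theorem exists_measurableEquiv_plaquetteKernelLayer :
    ∃ Ψ : GaugeConfig d L G ≃ᵐ GaugeConfig d L G,
      (⇑Ψ = fun (V : GaugeConfig d L G) (e : Edge d L) =>
        if p e then hol V e (plaquetteHolonomy V e.1 e.2 (ν e)) *
          (plaquetteHolonomy V e.1 e.2 (ν e))⁻¹ * V e
        else V e) ∧
      (⇑Ψ.symm = Theory2.coupleFun p fun a y v =>
        (φ a y).symm (v * (y ⟨_, h1 a.1 a.2⟩ * (y ⟨_, h2 a.1 a.2⟩)⁻¹ * (y ⟨_, h3 a.1 a.2⟩)⁻¹)) *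
          (y ⟨_, h1 a.1 a.2⟩ * (y ⟨_, h2 a.1 a.2⟩)⁻¹ * (y ⟨_, h3 a.1 a.2⟩)⁻¹)⁻¹) := by
  -- the staple and the loop are measurable in (link, frozen links)
  have hev : ∀ f₀ : {f : Edge d L // ¬p f}, Measurable fun y : ({f : Edge d L // ¬p f} → G) => y f₀ :=
    fun f₀ => measurable_pi_apply f₀
  have hS : ∀ a : {e // p e}, Measurable fun y : ({f : Edge d L // ¬p f} → G) =>
      y ⟨_, h1 a.1 a.2⟩ * (y ⟨_, h2 a.1 a.2⟩)⁻¹ * (y ⟨_, h3 a.1 a.2⟩)⁻¹ := fun a =>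
    ((hev _).mul (hev _).inv).mul (hev _).inv
  have hloop : ∀ a : {e // p e}, Measurable fun q : G × ({f : Edge d L // ¬p f} → G) =>
      q.1 * (q.2 ⟨_, h1 a.1 a.2⟩ * (q.2 ⟨_, h2 a.1 a.2⟩)⁻¹ * (q.2 ⟨_, h3 a.1 a.2⟩)⁻¹) := fun a =>
    measurable_fst.mul ((hS a).comp measurable_snd)
  -- single-link equivalences `u ↦ φ(uS) S⁻¹`
  set ψ : {e // p e} → ({f : Edge d L // ¬p f} → G) → G ≃ᵐ G := fun a y =>
    { toFun := fun u => φ a y (u * (y ⟨_, h1 a.1 a.2⟩ * (y ⟨_, h2 a.1 a.2⟩)⁻¹ * (y ⟨_, h3 a.1 a.2⟩)⁻¹)) *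
        (y ⟨_, h1 a.1 a.2⟩ * (y ⟨_, h2 a.1 a.2⟩)⁻¹ * (y ⟨_, h3 a.1 a.2⟩)⁻¹)⁻¹
      invFun := fun v => (φ a y).symm (v * (y ⟨_, h1 a.1 a.2⟩ * (y ⟨_, h2 a.1 a.2⟩)⁻¹ * (y ⟨_, h3 a.1 a.2⟩)⁻¹)) *
        (y ⟨_, h1 a.1 a.2⟩ * (y ⟨_, h2 a.1 a.2⟩)⁻¹ * (y ⟨_, h3 a.1 a.2⟩)⁻¹)⁻¹
      left_inv := fun u => by
        simp only [inv_mul_cancel_right, MeasurableEquiv.symm_apply_apply, mul_inv_cancel_right]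
      right_inv := fun v => by
        simp only [inv_mul_cancel_right, MeasurableEquiv.apply_symm_apply, mul_inv_cancel_right]
      measurable_toFun := ((φ a y).measurable.comp (measurable_id.mul_const _)).mul_const _
      measurable_invFun := ((φ a y).symm.measurable.comp (measurable_id.mul_const _)).mul_const _ }
    with hψdef
  have hψm : ∀ a, Measurable fun q : G × ({f : Edge d L // ¬p f} → G) => ψ a q.2 q.1 := fun a =>
    ((hφm a).comp ((hloop a).prodMk measurable_snd)).mul ((hS a).comp measurable_snd).inv
  have hψsm : ∀ a, Measurable fun q : G × ({f : Edge d L // ¬p f} → G) => (ψ a q.2).symm q.1 :=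
    fun a => ((hφsm a).comp ((hloop a).prodMk measurable_snd)).mul ((hS a).comp measurable_snd).inv
  have hbridge := plaquetteKernelLayer_eq_coupleFun p ν hol H hHV h1 h2 h3
  have hψeq : (fun (a : {e // p e}) (y : {f : Edge d L // ¬p f} → G) (u : G) =>
      H a.1 y (u * (y ⟨_, h1 a.1 a.2⟩ * (y ⟨_, h2 a.1 a.2⟩)⁻¹ * (y ⟨_, h3 a.1 a.2⟩)⁻¹)) *
        (u * (y ⟨_, h1 a.1 a.2⟩ * (y ⟨_, h2 a.1 a.2⟩)⁻¹ * (y ⟨_, h3 a.1 a.2⟩)⁻¹))⁻¹ * u) =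
      fun a y u => ψ a y u := by
    funext a y u
    rw [kernel_update_eq, hHφ]
    rfl
  refine ⟨coupleEquiv ψ hψm hψsm, ?_, ?_⟩
  · rw [coe_coupleEquiv, hbridge, hψeq]
  · rfl

end Equiv

section Jacobian

variable [TopologicalSpace G] [IsTopologicalGroup G] [CompactSpace G] [MeasurableSpace G] [BorelSpace G]
  [MeasurableMul₂ G] [MeasurableInv G] [NeZero L]
  (p : Edge d L → Prop) [DecidablePred p] (ν : Edge d L → Fin d)
  (h1 : ∀ e, p e → ¬p (e.1.shift e.2, ν e)) (h2 : ∀ e, p e → ¬p (e.1.shift (ν e), e.2))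
  (h3 : ∀ e, p e → ¬p (e.1, ν e))
  (hol : GaugeConfig d L G → Edge d L → G → G)
  (H : Edge d L → ({f : Edge d L // ¬p f} → G) → G → G)
  (hHV : ∀ (V : GaugeConfig d L G) (e : Edge d L), p e → hol V e = H e (fun f => V f))
  (φ : {e : Edge d L // p e} → ({f : Edge d L // ¬p f} → G) → G ≃ᵐ G)
  (hHφ : ∀ (a : {e : Edge d L // p e}) y, H a.1 y = ⇑(φ a y))
  (hφm : ∀ a, Measurable fun q : G × ({f : Edge d L // ¬p f} → G) => φ a q.2 q.1)
  (hφsm : ∀ a, Measurable fun q : G × ({f : Edge d L // ¬p f} → G) => (φ a q.2).symm q.1)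
  (j : Edge d L → ({f : Edge d L // ¬p f} → G) → G → ℝ)
  (hjm : ∀ a : {e : Edge d L // p e}, Measurable fun q : G × ({f : Edge d L // ¬p f} → G) => j a.1 q.2 q.1)
  (hJ : ∀ (a : {e : Edge d L // p e}) y, HasJacobian (haarProbability G) (φ a y) fun g => ENNReal.ofReal (j a.1 y g))
  (hj0 : ∀ (a : {e : Edge d L // p e}) y g, 0 ≤ j a.1 y g)

include hHV hHφ hφm hφsm hjm hJ hj0 in
/-- **… and with certified kernels it is an EXACT automorphism.**  Compact `G`, reference
`⊗_links haarProbability G`; the active kernels `φ a y` carry certificates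
`HasJacobian (haarProbability G) (φ a y) (ofReal ∘ j a y)` with `j a y ≥ 0` jointly measurable.  Then
there is `Ψ : GaugeConfig d L G ≃ᵐ GaugeConfig d L G` with `⇑Ψ =` the plaquette kernel layer and
`HasJacobian (⊗ Haar) Ψ (ofReal ∘ Theory2.coupleJac p (j at the loops))`. -/
theorem exists_measurableEquiv_plaquetteKernelLayer_hasJacobian :
    ∃ Ψ : GaugeConfig d L G ≃ᵐ GaugeConfig d L G,
      (⇑Ψ = fun (V : GaugeConfig d L G) (e : Edge d L) =>
        if p e then hol V e (plaquetteHolonomy V e.1 e.2 (ν e)) *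
          (plaquetteHolonomy V e.1 e.2 (ν e))⁻¹ * V e
        else V e) ∧
      HasJacobian (MeasureTheory.Measure.pi fun _ : Edge d L => haarProbability G) Ψ
        fun V => ENNReal.ofReal (Theory2.coupleJac p (fun a y u =>
          j a.1 y (u * (y ⟨_, h1 a.1 a.2⟩ * (y ⟨_, h2 a.1 a.2⟩)⁻¹ * (y ⟨_, h3 a.1 a.2⟩)⁻¹))) V) := by
  obtain ⟨Ψ, hΨ, -⟩ := exists_measurableEquiv_plaquetteKernelLayer p ν h1 h2 h3 hol H hHV φ hHφ hφm hφsm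
  refine ⟨Ψ, hΨ, ?_⟩
  have hev : ∀ f₀ : {f : Edge d L // ¬p f}, Measurable fun y : ({f : Edge d L // ¬p f} → G) => y f₀ :=
    fun f₀ => measurable_pi_apply f₀
  have hS : ∀ a : {e // p e}, Measurable fun y : ({f : Edge d L // ¬p f} → G) =>
      y ⟨_, h1 a.1 a.2⟩ * (y ⟨_, h2 a.1 a.2⟩)⁻¹ * (y ⟨_, h3 a.1 a.2⟩)⁻¹ := fun a =>
    ((hev _).mul (hev _).inv).mul (hev _).inv
  have hloop : ∀ a : {e // p e}, Measurable fun q : G × ({f : Edge d L // ¬p f} → G) =>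
      q.1 * (q.2 ⟨_, h1 a.1 a.2⟩ * (q.2 ⟨_, h2 a.1 a.2⟩)⁻¹ * (q.2 ⟨_, h3 a.1 a.2⟩)⁻¹) := fun a =>
    measurable_fst.mul ((hS a).comp measurable_snd)
  have hHm : ∀ a : {e // p e}, Measurable fun q : G × ({f : Edge d L // ¬p f} → G) => H a.1 q.2 q.1 := by
    intro a
    simp_rw [hHφ]
    exact hφm a
  rw [hΨ]
  refine hasJacobian_plaquetteKernelLayer p ν hol H j hHV h1 h2 h3 (fun a => ?_)
    (fun a => ?_) (fun a y => ?_) hj0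
  · exact (((hHm a).comp ((hloop a).prodMk measurable_snd)).mul (hloop a).inv).mul measurable_fst
  · exact (hjm a).comp ((hloop a).prodMk measurable_snd)
  · rw [hHφ]; exact hJ a y

end Jacobian

end Summit.Ventures.LatticeQCDFlow.Exactness
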